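import Literature.NumberTheory.ComplexMultiplication.CMOrderCohenMacaulayTypeBound
import Mathlib.Data.ZMod.QuotientRing
import Mathlib.NumberTheory.NumberField.Basic
import HarnessLib

/-!
# The bound `type ≤ [K:ℚ] − 1` is attained by the order `ℤ + p𝒪_K` (MARSEGLIA 2024 PROPOSITION 4.9, second half =
# MAIN THEOREM 1 (3), «Moreover»): its prime `p𝒪_K` has residue field `𝔽_p`, is its conductor and its only
# non-invertible prime, and has Cohen–Macaulay type `[K:ℚ] − 1`

Family `hodge`, lane `lit-hodgefound` (Track 2 foundations library; seat p15, row g28-#2), topic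
`Literature/NumberTheory/ComplexMultiplication`, namespace `Literature.NumberTheory.ComplexMultiplication.CMTypeLattice`
(the order `𝔯 = endOrder (M_μ)` of a `ℚ`-basis `μ` of a number field `K` of degree `#ι = [K:ℚ]`; here under the
hypothesis `∀ x, x ∈ 𝔯 ↔ ∃ (m : ℤ) (y : 𝓞 K), x = m + p·y`, i.e. `𝔯 = ℤ + p𝒪_K`).  THEOREMS ONLY: no definition, no
instance, no named fact (net Literature debt `0`).  Vocabulary: the maximal order `𝒪_K` is an idempotent fractional
ideal `M = MM` with `↑M = range (algebraMap (𝓞 K) K)` (`EndOrder.exists_idempotent_coe_eq_range`); the local type is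
`type_𝔭(𝔯) = dim_{𝔯/𝔭} 𝔯ᵗ/𝔭𝔯ᵗ = finrank (𝔯 ⧸ 𝔭) (↥↑T ⧸ 𝔭 • ⊤)` with `↑T = traceDual ℤ ℚ ↑1`
(`CMOrderCohenMacaulayTypeOne`); the conductor is `EndOrder.conductorIdeal` (`CMOrderConductor`).

## Source, VERBATIM

S. Marseglia, *Cohen-Macaulay type of orders, generators and ideal classes*, J. Algebra 658 (2024) 247–276
[Marseglia2024CMType] (arXiv:2206.03758, held `paper:arxiv-2206.03758`), §4, chunks p0011–p0012:

> "Proposition 4.9. Assume that `dim_Q(K) > 1`. Then the type of an order in `K` is bounded by `dim_Q(K) − 1`.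
> Moreover, this bound is attained: for any prime `p` of `Z` the order `T = Z + p𝒪_K` satisfies
> `type(T) = dim_Q(K) − 1`.  Proof. […] Now we prove the second part. Let `p` be any prime of `Z` and define
> `T = Z + p𝒪_K` as in the statement. Put `F_p = Z/p`. We have a ring isomorphism `T/p𝒪_K ≃ Z/(Z ∩ p𝒪_K) = F_p`,
> where the last equality holds because `Z ∩ p𝒪_K = p` by maximality of `p`. In particular, we get that `p𝒪_K` is a
> prime of `T` with residue field isomorphic to `F_p`. Since `dim_Q(K) = dim_{F_p}(𝒪_K/p𝒪_K) > 1` we see that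
> `T ≠ 𝒪_K`. Thus the inclusion `p𝒪_K ⊆ (T:𝒪_K)` is an equality. Hence Lemma 2.14.(i) tells us that `p𝒪_K` is
> the unique non-invertible prime of `T`. Then Proposition 3.3 gives us that `type(T) = type_{p𝒪_K}(T)`. Note that
> the multiplicator ring of `p𝒪_K` is `𝒪_K`. Using Proposition 3.5, we get
> `type(T) = dim_{F_p} 𝒪_K/p𝒪_K − 1 = dim_Q(K) − 1`."

and §1, chunk p0003, Main Theorem 1 (3): "Moreover, this bound is attained: if `p` is a prime of `Z` then the order
`T = Z + p𝒪_K` satisfies `type(T) = dim_Q(K) − 1`."  (Here `Z = ℤ`, `Q = ℚ`, `K` a number field.)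

## What is formalised (the printed proof, step by step)

* §1 `mem_endOrder_iff_of_one_mem_of_mul_mem`: a lattice `⊕ ℤνⱼ` which is a ring is its own order; the lattice
  `ℤ·1 + p𝒪_K` (`mem_span_one_sup_range_iff`) and **`exists_basis_mem_endOrder_iff`: the order `T = ℤ + p𝒪_K`
  exists in the tree's vocabulary**, `∃ ν, ∀ x, x ∈ endOrder (M_ν) ↔ ∃ m y, x = m + p·y`.
* §2 (for `𝔯 = ℤ + p𝒪_K`): the ideal `𝔭 = p𝒪_K` of `𝔯` (`exists_ideal_mem_iff`, `coeIdeal_eq_spanSingleton_mul`);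
  «`Z ∩ p𝒪_K = p`» (`intCast_mem_iff`); **«`T/p𝒪_K ≃ F_p`» (`nonempty_ringEquiv_zmod`)**, so `𝔭` is maximal with
  `#(𝔯/𝔭) = p` (`isMaximal`, `natCard_quotient_eq`); «`dim_{F_p} 𝒪_K/p𝒪_K = dim_Q K`» as `#(𝒪_K/p𝒪_K) = p^{[K:ℚ]}`
  (`natCard_quotient_coe_comap_eq_pow`); «`T ≠ 𝒪_K`» (`exists_coe_not_mem`, `[K:ℚ] ≥ 2`); **«`p𝒪_K = (T:𝒪_K)`»
  (`conductorIdeal_eq`)**; **«`p𝒪_K` is the unique non-invertible prime of `T`» (`not_isUnit_coeIdeal`,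
  `eq_of_not_isUnit_coeIdeal`)**; «the multiplicator ring of `p𝒪_K` is `𝒪_K`» (`coeIdeal_div_self_eq`).
* §3 **PROPOSITION 4.9, attainment: `finrank_traceDual_quotient_eq_card_sub_one` (`type_𝔭(ℤ + p𝒪_K) = [K:ℚ] − 1` at
  `𝔭 = p𝒪_K`)**, `finrank_traceDual_quotient_eq_one_of_ne` (`= 1` at every other prime), the «`type(T) = dim_Q(K) − 1`»
  package `type_eq_card_sub_one` (`≤ [K:ℚ] − 1` at every prime, `CMOrderCohenMacaulayTypeBound`, with equality at
  `p𝒪_K`), and the basis-free existence statement **`exists_order_type_eq_card_sub_one`** (every number field of degree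
  `≥ 2` has, for every prime `p`, an order with a prime of type `[K:ℚ] − 1`).
-/

noncomputable section

open scoped nonZeroDivisors NumberField Pointwise
open NumberField Module FractionalIdeal
open Submodule (traceDual)

namespace Literature.NumberTheory.ComplexMultiplication

namespace CMTypeLattice

variable {K : Type} [Field K] [NumberField K]
variable {ι : Type} [Fintype ι] [DecidableEq ι]

/-! ## §1 The order `ℤ + p𝒪_K` exists: a lattice which is a ring is its own order -/

/-- **A lattice `L = ⊕ ℤνⱼ` of `K` which is a ring (`1 ∈ L`, `LL ⊆ L`) IS its own order: `{α : αL ⊆ L} = L`** —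
so every order of `K` is an `endOrder (M_ν)` («`𝔯` is the "order" of the module `𝔪`», here with `𝔪 = 𝔯`).
[cite: Shimura1998, §6.1, p. 41] [cite: Marseglia2024CMType, §2.2 («A `Z`-order in `K` is a subring of `K` which is
also a `Z`-lattice in `K`»), p. 5] -/
theorem mem_endOrder_iff_of_one_mem_of_mul_mem (ν : Basis ι ℚ K) (h1 : (1 : K) ∈ Submodule.span ℤ (Set.range ν))
    (hmul : ∀ a ∈ Submodule.span ℤ (Set.range ν), ∀ b ∈ Submodule.span ℤ (Set.range ν),
      a * b ∈ Submodule.span ℤ (Set.range ν)) (x : K) :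
    x ∈ endOrder (Algebra.leftMulMatrix ν) ↔ x ∈ Submodule.span ℤ (Set.range ν) := by
  rw [mem_endOrder_leftMulMatrix_iff_forall]
  exact ⟨fun h ↦ by simpa using h 1 h1, fun hx y hy ↦ hmul x hx y hy⟩

omit [NumberField K] in
/-- The lattice `ℤ·1 + p𝒪_K ⊆ K`, as `ℤ1 ⊔ range (y ↦ p·y)`: membership is `x = m + p·y` with `m ∈ ℤ`, `y ∈ 𝒪_K`
(«the order `T = Z + p𝒪_K`»). [cite: Marseglia2024CMType, §4 Prop. 4.9, p. 11] -/
theorem mem_span_one_sup_range_iff (p : ℕ) (x : K) :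
    x ∈ Submodule.span ℤ {(1 : K)} ⊔ LinearMap.range ((LinearMap.mulLeft ℤ (p : K)).comp
        ((Algebra.linearMap (𝓞 K) K).restrictScalars ℤ)) ↔ ∃ (m : ℤ) (y : 𝓞 K), x = m + p * y := by
  rw [Submodule.mem_sup]
  constructor
  · rintro ⟨a, ha, b, hb, rfl⟩
    obtain ⟨m, rfl⟩ := Submodule.mem_span_singleton.1 ha
    obtain ⟨y, rfl⟩ := LinearMap.mem_range.1 hb
    exact ⟨m, y, by rw [zsmul_eq_mul, mul_one]; rfl⟩
  · rintro ⟨m, y, rfl⟩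
    exact ⟨(m : K), Submodule.mem_span_singleton.2 ⟨m, by rw [zsmul_eq_mul, mul_one]⟩, (p : K) * y,
      LinearMap.mem_range.2 ⟨y, rfl⟩, rfl⟩

/-- **The order `T = ℤ + p𝒪_K` in the tree's vocabulary: for every `p ≠ 0` there is a `ℚ`-basis `ν` of `K` whose
order `endOrder (M_ν)` is exactly `{m + p·y : m ∈ ℤ, y ∈ 𝒪_K}`** (`ℤ·1 + p𝒪_K` is a finitely generated lattice
spanning `K` — it contains `p` times an integral basis —, hence `⊕ ℤνⱼ` for a basis `ν` indexed like `μ₀`; it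
contains `1` and is closed under products, so it is its own order). [cite: Marseglia2024CMType, §4 Prop. 4.9 («for
any prime `p` of `Z` the order `T = Z + p𝒪_K`»), p. 11] -/
theorem exists_basis_mem_endOrder_iff (μ₀ : Basis ι ℚ K) {p : ℕ} (hp0 : p ≠ 0) :
    ∃ ν : Basis ι ℚ K, ∀ x : K, x ∈ endOrder (Algebra.leftMulMatrix ν) ↔ ∃ (m : ℤ) (y : 𝓞 K), x = m + p * y := by
  set N : Submodule ℤ K := Submodule.span ℤ {(1 : K)} ⊔ LinearMap.range ((LinearMap.mulLeft ℤ (p : K)).comp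
    ((Algebra.linearMap (𝓞 K) K).restrictScalars ℤ)) with hN
  have hmem : ∀ x : K, x ∈ N ↔ ∃ (m : ℤ) (y : 𝓞 K), x = m + p * y := mem_span_one_sup_range_iff p
  -- `N` is finitely generated and spans `K`
  have hfg : N.FG := by
    refine Submodule.FG.sup (Submodule.fg_span_singleton _) ?_
    rw [← Submodule.map_top]
    exact Submodule.FG.map _ Module.Finite.fg_top
  have hp0K : (p : K) ≠ 0 := Nat.cast_ne_zero.2 hp0
  have hsp : (⊤ : Submodule ℚ K) ≤ Submodule.span ℚ (N : Set K) := by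
    rw [← (NumberField.integralBasis K).span_eq, Submodule.span_le]
    rintro _ ⟨i, rfl⟩
    have hi : (p : K) * (RingOfIntegers.basis K i : K) ∈ N := (hmem _).2 ⟨0, RingOfIntegers.basis K i, by simp⟩
    have : NumberField.integralBasis K i = (p : ℚ)⁻¹ • ((p : K) * (RingOfIntegers.basis K i : K)) := by
      rw [NumberField.integralBasis_apply, Algebra.smul_def, map_inv₀, map_natCast, ← mul_assoc,
        inv_mul_cancel₀ hp0K, one_mul]
    rw [this]
    exact Submodule.smul_mem _ _ (Submodule.subset_span hi)
  obtain ⟨ν, hν⟩ := exists_basis_span_eq_of_fg μ₀ N hfg hsp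
  refine ⟨ν, fun x ↦ ?_⟩
  rw [← hmem, ← hν]
  refine mem_endOrder_iff_of_one_mem_of_mul_mem ν ?_ ?_ x
  · rw [hν, hmem]
    exact ⟨1, 0, by simp⟩
  · intro a ha b hb
    rw [hν, hmem] at ha hb ⊢
    obtain ⟨m, y, rfl⟩ := ha
    obtain ⟨m', y', rfl⟩ := hb
    refine ⟨m * m', (m : 𝓞 K) * y' + (m' : 𝓞 K) * y + (p : 𝓞 K) * (y * y'), ?_⟩
    simp only [RingOfIntegers.coe_eq_algebraMap, map_add, map_mul, map_intCast, map_natCast, Int.cast_mul]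
    ring

/-! ## §2 The order `𝔯 = ℤ + p𝒪_K`: its prime `𝔭 = p𝒪_K`, residue field `𝔽_p`, conductor and singular prime -/

section ZPlusP

variable (μ : Basis ι ℚ K) [Nonempty ι] [IsFractionRing (endOrder (Algebra.leftMulMatrix μ)) K] {p : ℕ}

omit [Nonempty ι] [IsFractionRing (endOrder (Algebra.leftMulMatrix μ)) K] in
/-- **The ideal `𝔭 = p𝒪_K` of `T = ℤ + p𝒪_K`**: the elements `p·y`, `y ∈ 𝒪_K`, of `𝔯` form an ideal.
[cite: Marseglia2024CMType, §4 Prop. 4.9 (proof: «`p𝒪_K` is a prime of `T`»), p. 12] -/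
theorem exists_ideal_mem_iff
    (h𝔯 : ∀ x : K, x ∈ endOrder (Algebra.leftMulMatrix μ) ↔ ∃ (m : ℤ) (y : 𝓞 K), x = m + p * y) :
    ∃ 𝔭 : Ideal (endOrder (Algebra.leftMulMatrix μ)), ∀ r, r ∈ 𝔭 ↔ ∃ y : 𝓞 K, (r : K) = p * y := by
  refine ⟨{ carrier := {r | ∃ y : 𝓞 K, (r : K) = p * y}
            add_mem' := ?_
            zero_mem' := ⟨0, by simp⟩
            smul_mem' := ?_ }, fun r ↦ Iff.rfl⟩
  · rintro a b ⟨y, hy⟩ ⟨y', hy'⟩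
    refine ⟨y + y', ?_⟩
    rw [Subring.coe_add, hy, hy', RingOfIntegers.coe_eq_algebraMap, RingOfIntegers.coe_eq_algebraMap,
      RingOfIntegers.coe_eq_algebraMap, map_add, mul_add]
  · rintro c r ⟨y, hy⟩
    obtain ⟨m, y₀, hc⟩ := (h𝔯 c).1 c.2
    refine ⟨(m : 𝓞 K) * y + (p : 𝓞 K) * (y₀ * y), ?_⟩
    rw [smul_eq_mul, Subring.coe_mul, hy, hc]
    simp only [RingOfIntegers.coe_eq_algebraMap, map_add, map_mul, map_intCast, map_natCast]
    ring

variable (h𝔯 : ∀ x : K, x ∈ endOrder (Algebra.leftMulMatrix μ) ↔ ∃ (m : ℤ) (y : 𝓞 K), x = m + p * y)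
  {𝔭 : Ideal (endOrder (Algebra.leftMulMatrix μ))} (h𝔭 : ∀ r, r ∈ 𝔭 ↔ ∃ y : 𝓞 K, (r : K) = p * y)
include h𝔯 h𝔭

omit [Nonempty ι] [IsFractionRing (endOrder (Algebra.leftMulMatrix μ)) K] h𝔭 in
/-- `p·y ∈ 𝔯` for every `y ∈ 𝒪_K` (the summand `p𝒪_K ⊆ T`). [cite: Marseglia2024CMType, §4 Prop. 4.9, p. 11] -/
theorem natCast_mul_coe_mem (y : 𝓞 K) : (p : K) * y ∈ endOrder (Algebra.leftMulMatrix μ) :=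
  (h𝔯 _).2 ⟨0, y, by simp⟩

omit [Nonempty ι] in
/-- As a fractional ideal, `𝔭 = p·𝒪_K = p·M`. [cite: Marseglia2024CMType, §4 Prop. 4.9 (proof), p. 12] -/
theorem coeIdeal_eq_spanSingleton_mul {M : FractionalIdeal (endOrder (Algebra.leftMulMatrix μ))⁰ K}
    (hMO : (M : Set K) = (algebraMap (𝓞 K) K).range) :
    (𝔭 : FractionalIdeal (endOrder (Algebra.leftMulMatrix μ))⁰ K) =
      spanSingleton (endOrder (Algebra.leftMulMatrix μ))⁰ (p : K) * M := by
  have hmemM : ∀ z : K, z ∈ M ↔ ∃ y : 𝓞 K, (y : K) = z := fun z ↦ by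
    rw [← FractionalIdeal.mem_coe, ← SetLike.mem_coe]
    change z ∈ (M : Set K) ↔ _
    rw [hMO]
    exact ⟨fun ⟨y, hy⟩ ↦ ⟨y, hy⟩, fun ⟨y, hy⟩ ↦ ⟨y, hy⟩⟩
  ext x
  rw [mem_coeIdeal, mem_singleton_mul]
  constructor
  · rintro ⟨r, hr, rfl⟩
    obtain ⟨y, hy⟩ := (h𝔭 r).1 hr
    exact ⟨y, (hmemM _).2 ⟨y, rfl⟩, hy⟩
  · rintro ⟨z, hz, rfl⟩
    obtain ⟨y, rfl⟩ := (hmemM z).1 hz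
    exact ⟨⟨(p : K) * y, natCast_mul_coe_mem μ h𝔯 y⟩, (h𝔭 _).2 ⟨y, rfl⟩, rfl⟩

omit [Nonempty ι] [IsFractionRing (endOrder (Algebra.leftMulMatrix μ)) K] h𝔯 in
/-- **«`Z ∩ p𝒪_K = p`»: an integer `m` lies in `𝔭 = p𝒪_K` iff `p ∣ m`** (`m/p ∈ 𝒪_K ∩ ℚ = ℤ`, `ℤ` integrally
closed; `p` prime, in fact any `p ≠ 0`). [cite: Marseglia2024CMType, §4 Prop. 4.9 (proof: «`Z ∩ p𝒪_K = p` by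
maximality of `p`»), p. 12] -/
theorem intCast_mem_iff (hp0 : p ≠ 0) (m : ℤ) : (m : endOrder (Algebra.leftMulMatrix μ)) ∈ 𝔭 ↔ (p : ℤ) ∣ m := by
  have hp0K : (p : K) ≠ 0 := Nat.cast_ne_zero.2 hp0
  constructor
  · rintro hm
    obtain ⟨y, hy⟩ := (h𝔭 _).1 hm
    rw [SubringClass.coe_intCast] at hy
    -- `y = m/p` is a rational algebraic integer, hence an integer
    have hyq : (y : K) = algebraMap ℚ K ((m : ℚ) / p) := by
      rw [map_div₀, map_intCast, map_natCast, eq_div_iff hp0K, mul_comm, hy]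
    have hint : IsIntegral ℤ ((m : ℚ) / p) :=
      (isIntegral_algebraMap_iff (algebraMap ℚ K).injective).1 (hyq ▸ RingOfIntegers.isIntegral_coe y)
    obtain ⟨z, hz⟩ := (IsIntegrallyClosed.isIntegral_iff (R := ℤ) (K := ℚ)).1 hint
    refine ⟨z, ?_⟩
    have hz' : (z : ℚ) * p = m := by
      rw [eq_intCast] at hz
      rw [hz, div_mul_cancel₀ _ (Nat.cast_ne_zero.2 hp0 : (p : ℚ) ≠ 0)]
    exact_mod_cast (by rw [mul_comm] at hz'; exact hz'.symm : (m : ℚ) = p * z)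
  · rintro ⟨k, rfl⟩
    exact (h𝔭 _).2 ⟨(k : 𝓞 K), by simp⟩

omit [Nonempty ι] [IsFractionRing (endOrder (Algebra.leftMulMatrix μ)) K] in
/-- **«`T/p𝒪_K ≃ Z/(Z ∩ p𝒪_K) = F_p`»: the residue ring of `𝔯 = ℤ + p𝒪_K` at `𝔭 = p𝒪_K` is `ℤ/pℤ`** (`ℤ → 𝔯/𝔭` is
onto since `m + p·y ≡ m`, with kernel `ℤ ∩ p𝒪_K = pℤ`). [cite: Marseglia2024CMType, §4 Prop. 4.9 (proof), p. 12] -/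
theorem nonempty_ringEquiv_zmod (hp0 : p ≠ 0) : Nonempty (endOrder (Algebra.leftMulMatrix μ) ⧸ 𝔭 ≃+* ZMod p) := by
  set φ : ℤ →+* endOrder (Algebra.leftMulMatrix μ) ⧸ 𝔭 :=
    (Ideal.Quotient.mk 𝔭).comp (Int.castRingHom (endOrder (Algebra.leftMulMatrix μ))) with hφ
  have hφm : ∀ m : ℤ, φ m = Ideal.Quotient.mk 𝔭 (m : endOrder (Algebra.leftMulMatrix μ)) := fun m ↦ rfl
  -- onto: `r = m + p·y ≡ m`
  have hsurj : Function.Surjective φ := by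
    intro q
    obtain ⟨r, rfl⟩ := Ideal.Quotient.mk_surjective q
    obtain ⟨m, y, hr⟩ := (h𝔯 r).1 r.2
    refine ⟨m, ?_⟩
    rw [hφm, Ideal.Quotient.eq]
    refine (h𝔭 _).2 ⟨-y, ?_⟩
    rw [AddSubgroupClass.coe_sub, SubringClass.coe_intCast, hr, RingOfIntegers.coe_eq_algebraMap,
      RingOfIntegers.coe_eq_algebraMap, map_neg]
    ring
  -- kernel `pℤ`
  have hker : RingHom.ker φ = Ideal.span {(p : ℤ)} := by
    ext m
    rw [RingHom.mem_ker, hφm, Ideal.Quotient.eq_zero_iff_mem, intCast_mem_iff μ h𝔭 hp0, Ideal.mem_span_singleton]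
  exact ⟨((Ideal.quotEquivOfEq hker).symm.trans (RingHom.quotientKerEquivOfSurjective hsurj)).symm.trans
    (Int.quotientSpanNatEquivZMod p)⟩

omit [Nonempty ι] [IsFractionRing (endOrder (Algebra.leftMulMatrix μ)) K] in
/-- **«`p𝒪_K` is a prime of `T` with residue field isomorphic to `F_p`»: `𝔭` is a maximal ideal of `𝔯 = ℤ + p𝒪_K`**
(`p` prime). [cite: Marseglia2024CMType, §4 Prop. 4.9 (proof), p. 12] -/
theorem isMaximal (hp : p.Prime) : 𝔭.IsMaximal := by
  haveI := Fact.mk hp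
  obtain ⟨e⟩ := nonempty_ringEquiv_zmod μ h𝔯 h𝔭 hp.ne_zero
  exact Ideal.Quotient.maximal_of_isField 𝔭 (MulEquiv.isField (Field.toIsField (ZMod p)) e.toMulEquiv)

omit [Nonempty ι] [IsFractionRing (endOrder (Algebra.leftMulMatrix μ)) K] in
/-- `#(𝔯/𝔭) = p`: the residue field of `ℤ + p𝒪_K` at `p𝒪_K` has `p` elements. [cite: Marseglia2024CMType, §4
Prop. 4.9 (proof: «residue field isomorphic to `F_p`»), p. 12] -/
theorem natCard_quotient_eq (hp0 : p ≠ 0) : Nat.card (endOrder (Algebra.leftMulMatrix μ) ⧸ 𝔭) = p := by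
  obtain ⟨e⟩ := nonempty_ringEquiv_zmod μ h𝔯 h𝔭 hp0
  rw [Nat.card_congr e.toEquiv, Nat.card_zmod]

omit [Nonempty ι] [IsFractionRing (endOrder (Algebra.leftMulMatrix μ)) K] h𝔯 in
/-- `𝔭 ≠ 0` (it contains `p`). [cite: Marseglia2024CMType, §4 Prop. 4.9 (proof), p. 12] -/
theorem ne_bot (hp0 : p ≠ 0) : 𝔭 ≠ ⊥ := by
  intro h
  have hp𝔭 : ((p : ℤ) : endOrder (Algebra.leftMulMatrix μ)) ∈ 𝔭 :=
    (h𝔭 _).2 ⟨1, by rw [SubringClass.coe_intCast]; simp⟩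
  rw [h, Ideal.mem_bot, Int.cast_natCast, Nat.cast_eq_zero] at hp𝔭
  · exact hp0 hp𝔭

omit [Nonempty ι] in
/-- **«`dim_Q(K) = dim_{F_p}(𝒪_K/p𝒪_K)`», as an index: `#(𝒪_K/p𝒪_K) = [M : 𝔭] = p^{[K:ℚ]}`** (the lattice of
`𝔭 = pM` is `p` times a `ℤ`-basis of the lattice of `M`, so the index is `|det (p·1)| = p^{#ι}`,
`CMLatticeTraceDualIndex`). [cite: Marseglia2024CMType, §4 Prop. 4.9 (proof), p. 12] -/
theorem natCard_quotient_coe_comap_eq_pow (hp0 : p ≠ 0) {M : FractionalIdeal (endOrder (Algebra.leftMulMatrix μ))⁰ K}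
    (hM0 : M ≠ 0) (hMO : (M : Set K) = (algebraMap (𝓞 K) K).range) :
    Nat.card (↥(M : Submodule (endOrder (Algebra.leftMulMatrix μ)) K) ⧸
      ((𝔭 : FractionalIdeal (endOrder (Algebra.leftMulMatrix μ))⁰ K) :
          Submodule (endOrder (Algebra.leftMulMatrix μ)) K).comap
        (M : Submodule (endOrder (Algebra.leftMulMatrix μ)) K).subtype) = p ^ Fintype.card ι := by
  classical
  have hp0Q : (p : ℚ) ≠ 0 := Nat.cast_ne_zero.2 hp0
  obtain ⟨ν, hν⟩ := exists_basis_span_eq_restrictScalars_coe μ hM0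
  -- the lattice of `𝔭 = pM` is spanned by `p·ν`
  set ν' : Basis ι ℚ K := ν.isUnitSMul (w := fun _ ↦ (p : ℚ)) (fun _ ↦ isUnit_iff_ne_zero.2 hp0Q) with hν'
  have hν'i : ∀ i, ν' i = (p : K) * ν i := fun i ↦ by
    rw [hν', Basis.isUnitSMul_apply, Algebra.smul_def, map_natCast]
  have hP : ((𝔭 : FractionalIdeal (endOrder (Algebra.leftMulMatrix μ))⁰ K) :
      Submodule (endOrder (Algebra.leftMulMatrix μ)) K).restrictScalars ℤ = Submodule.span ℤ (Set.range ν') := by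
    have hrange : Set.range ν' = (p : ℚ) • Set.range ν := by
      ext x
      simp only [Set.mem_range, Set.mem_smul_set, hν'i, Algebra.smul_def, map_natCast]
      constructor
      · rintro ⟨i, rfl⟩; exact ⟨ν i, ⟨i, rfl⟩, rfl⟩
      · rintro ⟨_, ⟨i, rfl⟩, rfl⟩; exact ⟨i, rfl⟩
    rw [hrange, ← Submodule.smul_span, hν, coeIdeal_eq_spanSingleton_mul μ h𝔯 h𝔭 hMO]
    ext x
    rw [Submodule.restrictScalars_mem, mem_coe, mem_singleton_mul, Submodule.mem_smul_pointwise_iff_exists]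
    constructor
    · rintro ⟨z, hz, rfl⟩
      exact ⟨z, hz, by rw [Algebra.smul_def, map_natCast]⟩
    · rintro ⟨z, hz, rfl⟩
      exact ⟨z, hz, by rw [Algebra.smul_def, map_natCast]⟩
  have hmemM : ∀ w : K, w ∈ M ↔ ∃ y : 𝓞 K, (y : K) = w := fun w ↦ by
    rw [← FractionalIdeal.mem_coe, ← SetLike.mem_coe]
    change w ∈ (M : Set K) ↔ _
    rw [hMO]
    exact ⟨fun ⟨y, hy⟩ ↦ ⟨y, hy⟩, fun ⟨y, hy⟩ ↦ ⟨y, hy⟩⟩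
  have hle : Submodule.span ℤ (Set.range ν') ≤ Submodule.span ℤ (Set.range ν) := by
    rw [← hP, hν]
    intro x hx
    rw [Submodule.restrictScalars_mem, mem_coe] at hx ⊢
    rw [coeIdeal_eq_spanSingleton_mul μ h𝔯 h𝔭 hMO, mem_singleton_mul] at hx
    obtain ⟨z, hz, rfl⟩ := hx
    obtain ⟨y, rfl⟩ := (hmemM z).1 hz
    exact (hmemM _).2 ⟨(p : 𝓞 K) * y, by simp only [RingOfIntegers.coe_eq_algebraMap, map_mul, map_natCast]⟩
  have key := natCard_quotient_comap_span_eq_abs_det ν ν' hle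
  rw [hν', Basis.det_isUnitSMul, Finset.prod_const, Finset.card_univ, abs_pow, Nat.abs_cast] at key
  rw [← natCard_quotient_comap_restrictScalars μ, natCard_quotient_comap_congr hν.symm hP]
  exact_mod_cast key

/-- **«`T ≠ 𝒪_K`» for `[K:ℚ] ≥ 2`: some algebraic integer is not in `ℤ + p𝒪_K`** (otherwise `M = 𝔯` and
`p^{[K:ℚ]} = #(M/𝔭) = #(𝔯/𝔭) = p`). [cite: Marseglia2024CMType, §4 Prop. 4.9 (proof: «Since
`dim_Q(K) = dim_{F_p}(𝒪_K/p𝒪_K) > 1` we see that `T ≠ 𝒪_K`»), p. 12] -/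
theorem exists_coe_not_mem (hp : p.Prime) (h2 : 2 ≤ Fintype.card ι) :
    ∃ y : 𝓞 K, (y : K) ∉ endOrder (Algebra.leftMulMatrix μ) := by
  by_contra hall
  push Not at hall
  haveI := isNoetherianRing_endOrder (Algebra.leftMulMatrix μ)
  obtain ⟨M, hM0, hMM, hMO⟩ := EndOrder.exists_idempotent_coe_eq_range (ρ := Algebra.leftMulMatrix μ)
  -- then `M = 1`
  have hM1 : M = 1 := by
    refine le_antisymm (fun x hx ↦ ?_) (FractionalIdeal.one_le.2 (EndOrder.one_mem_of_mul_self_eq hM0 hMM))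
    have hx' : x ∈ (M : Set K) := hx
    rw [hMO] at hx'
    obtain ⟨y, rfl⟩ := hx'
    exact (mem_one_iff _).2 ⟨⟨y, hall y⟩, rfl⟩
  have h := natCard_quotient_coe_comap_eq_pow μ h𝔯 h𝔭 hp.ne_zero hM0 hMO
  rw [hM1, natCard_quotient_coe_one_comap_coeIdeal μ 𝔭, natCard_quotient_eq μ h𝔯 h𝔭 hp.ne_zero] at h
  have h1 : p ^ 1 = p ^ Fintype.card ι := by rw [pow_one]; exact h
  have := Nat.pow_right_injective hp.two_le h1
  omega

/-- **«the inclusion `p𝒪_K ⊆ (T:𝒪_K)` is an equality»: the conductor of `ℤ + p𝒪_K` is `p𝒪_K`** (`[K:ℚ] ≥ 2`; if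
`r = m + p·y₀ ∈ 𝔣` with `p ∤ m` then `um + vp = 1` gives `y = u(my) + p(vy) ∈ T` for every `y ∈ 𝒪_K`, i.e. `T = 𝒪_K`).
[cite: Marseglia2024CMType, §4 Prop. 4.9 (proof), p. 12] -/
theorem conductorIdeal_eq (hp : p.Prime) (h2 : 2 ≤ Fintype.card ι) :
    EndOrder.conductorIdeal (Algebra.leftMulMatrix μ) = 𝔭 := by
  refine le_antisymm (fun r hr ↦ ?_) (fun r hr ↦ ?_)
  · -- `𝔣 ⊆ 𝔭`
    rw [EndOrder.mem_conductorIdeal_iff] at hr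
    obtain ⟨m, y₀, hrm⟩ := (h𝔯 r).1 r.2
    by_cases hdvd : (p : ℤ) ∣ m
    · obtain ⟨k, rfl⟩ := hdvd
      exact (h𝔭 r).2 ⟨(k : 𝓞 K) + y₀, by
        rw [hrm]; simp only [RingOfIntegers.coe_eq_algebraMap, map_add, map_intCast, Int.cast_mul,
          Int.cast_natCast]; ring⟩
    · exfalso
      obtain ⟨y, hy⟩ := exists_coe_not_mem μ h𝔯 h𝔭 hp h2
      have hcop : IsCoprime (p : ℤ) m :=
        (Irreducible.coprime_iff_not_dvd (Nat.prime_iff_prime_int.1 hp).irreducible).2 hdvd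
      obtain ⟨u, v, huv⟩ := hcop
      -- `m·y ∈ 𝔯`
      have hmy : (m : K) * y ∈ endOrder (Algebra.leftMulMatrix μ) := by
        have h1 : (r : K) * y ∈ endOrder (Algebra.leftMulMatrix μ) := hr y
        have h2' : (p : K) * ((y₀ * y : 𝓞 K) : K) ∈ endOrder (Algebra.leftMulMatrix μ) :=
          natCast_mul_coe_mem μ h𝔯 _
        have : (m : K) * y = (r : K) * y - (p : K) * ((y₀ * y : 𝓞 K) : K) := by
          rw [hrm]; simp only [RingOfIntegers.coe_eq_algebraMap, map_mul]; ring
        rw [this]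
        exact Subring.sub_mem _ h1 h2'
      refine hy ?_
      have : (y : K) = (v : K) * ((m : K) * y) + (p : K) * (((u : 𝓞 K) * y : 𝓞 K) : K) := by
        have huv' : (u : K) * p + v * m = 1 := by exact_mod_cast huv
        simp only [RingOfIntegers.coe_eq_algebraMap, map_mul, map_intCast]
        linear_combination -((y : K)) * huv'
      rw [this]
      exact Subring.add_mem _ (Subring.mul_mem _ (intCast_mem _ v) hmy)
        (natCast_mul_coe_mem μ h𝔯 _)
  · -- `𝔭 ⊆ 𝔣`
    rw [EndOrder.mem_conductorIdeal_iff]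
    intro y
    obtain ⟨y₀, hy₀⟩ := (h𝔭 r).1 hr
    rw [hy₀, RingOfIntegers.coe_eq_algebraMap, mul_assoc, ← map_mul]
    exact natCast_mul_coe_mem μ h𝔯 _

/-- **`𝔭 = p𝒪_K` is NOT invertible** (it contains — indeed equals — the conductor). [cite: Marseglia2024CMType, §4
Prop. 4.9 (proof: «`p𝒪_K` is the unique non-invertible prime of `T`»), p. 12] -/
theorem not_isUnit_coeIdeal (hp : p.Prime) (h2 : 2 ≤ Fintype.card ι) :
    ¬ IsUnit (𝔭 : FractionalIdeal (endOrder (Algebra.leftMulMatrix μ))⁰ K) := by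
  haveI := isMaximal μ h𝔯 h𝔭 hp
  rw [EndOrder.isUnit_coeIdeal_iff_not_conductorIdeal_le (Ideal.IsMaximal.isPrime ‹_›) (ne_bot μ h𝔭 hp.ne_zero),
    not_not, conductorIdeal_eq μ h𝔯 h𝔭 hp h2]

/-- **«`p𝒪_K` is the unique non-invertible prime of `T`» (Lemma 2.14 (i)): a nonzero prime `𝔮` of `ℤ + p𝒪_K` which
is not invertible is `p𝒪_K`.** [cite: Marseglia2024CMType, §4 Prop. 4.9 (proof), p. 12; §2.5 Lemma 2.14 (i), p. 7] -/
theorem eq_of_not_isUnit_coeIdeal (hp : p.Prime) (h2 : 2 ≤ Fintype.card ι)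
    {𝔮 : Ideal (endOrder (Algebra.leftMulMatrix μ))} [h𝔮 : 𝔮.IsPrime] (h0 : 𝔮 ≠ ⊥)
    (hu : ¬ IsUnit (𝔮 : FractionalIdeal (endOrder (Algebra.leftMulMatrix μ))⁰ K)) : 𝔮 = 𝔭 := by
  rw [EndOrder.isUnit_coeIdeal_iff_not_conductorIdeal_le h𝔮 h0, not_not, conductorIdeal_eq μ h𝔯 h𝔭 hp h2] at hu
  exact ((isMaximal μ h𝔯 h𝔭 hp).eq_of_le h𝔮.ne_top hu).symm

/-- **«the multiplicator ring of `p𝒪_K` is `𝒪_K`»: `(𝔭:𝔭) = (pM : pM) = (M : M) = M`.** [cite: Marseglia2024CMType,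
§4 Prop. 4.9 (proof), p. 12] -/
theorem coeIdeal_div_self_eq (hp0 : p ≠ 0) {M : FractionalIdeal (endOrder (Algebra.leftMulMatrix μ))⁰ K}
    (hM0 : M ≠ 0) (hMM : M * M = M) (hMO : (M : Set K) = (algebraMap (𝓞 K) K).range) :
    (𝔭 : FractionalIdeal (endOrder (Algebra.leftMulMatrix μ))⁰ K) / 𝔭 = M := by
  rw [coeIdeal_eq_spanSingleton_mul μ h𝔯 h𝔭 hMO,
    EndOrder.spanSingleton_mul_div_spanSingleton_mul (Nat.cast_ne_zero.2 hp0) hM0,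
    EndOrder.div_self_eq_of_mul_self_eq_endOrder hM0 hMM]

/-! ## §3 PROPOSITION 4.9, attainment: `type_𝔭(ℤ + p𝒪_K) = [K:ℚ] − 1` -/

/-- **MARSEGLIA 2024 PROPOSITION 4.9, «Moreover»: the order `T = ℤ + p𝒪_K` has Cohen–Macaulay type `[K:ℚ] − 1` at
its prime `𝔭 = p𝒪_K`**, `dim_{𝔯/𝔭} 𝔯ᵗ/𝔭𝔯ᵗ = #ι − 1` (`[K:ℚ] = #ι ≥ 2`, `p` prime): by PROPOSITION 3.5
(`CMLatticeTraceDualIndex`, cardinality form) `#((𝔭:𝔭)/𝔭) = #(𝔯/𝔭)^{type_𝔭 + 1}`, and `(𝔭:𝔭) = 𝒪_K`,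
`#(𝒪_K/p𝒪_K) = p^{[K:ℚ]}`, `#(𝔯/𝔭) = p`. [cite: Marseglia2024CMType, §4 Prop. 4.9, pp. 11–12; §1 Main Theorem 1 (3),
p. 3] -/
theorem finrank_traceDual_quotient_eq_card_sub_one (hp : p.Prime) (h2 : 2 ≤ Fintype.card ι)
    {T : FractionalIdeal (endOrder (Algebra.leftMulMatrix μ))⁰ K}
    (hT : (T : Submodule (endOrder (Algebra.leftMulMatrix μ)) K) =
      traceDual ℤ ℚ ((1 : FractionalIdeal (endOrder (Algebra.leftMulMatrix μ))⁰ K) :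
        Submodule (endOrder (Algebra.leftMulMatrix μ)) K)) :
    Module.finrank (endOrder (Algebra.leftMulMatrix μ) ⧸ 𝔭)
      ((T : Submodule (endOrder (Algebra.leftMulMatrix μ)) K) ⧸
        (𝔭 • ⊤ : Submodule (endOrder (Algebra.leftMulMatrix μ))
          (T : Submodule (endOrder (Algebra.leftMulMatrix μ)) K))) = Fintype.card ι - 1 := by
  haveI := isMaximal μ h𝔯 h𝔭 hp
  obtain ⟨M, hM0, hMM, hMO⟩ := EndOrder.exists_idempotent_coe_eq_range (ρ := Algebra.leftMulMatrix μ)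
  have key := natCard_quotient_div_self_comap_coeIdeal_eq_pow μ hT 𝔭 (not_isUnit_coeIdeal μ h𝔯 h𝔭 hp h2)
  rw [natCard_quotient_comap_congr (congr_arg _ (coeIdeal_div_self_eq μ h𝔯 h𝔭 hp.ne_zero hM0 hMM hMO)) rfl,
    natCard_quotient_coe_comap_eq_pow μ h𝔯 h𝔭 hp.ne_zero hM0 hMO, natCard_quotient_eq μ h𝔯 h𝔭 hp.ne_zero] at key
  have := Nat.pow_right_injective hp.two_le key
  omega

/-- **At every other nonzero prime `𝔮 ≠ p𝒪_K` the type of `ℤ + p𝒪_K` is `1`** (`𝔮` is invertible, PROP. 3.3) — «Then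
Proposition 3.3 gives us that `type(T) = type_{p𝒪_K}(T)`». [cite: Marseglia2024CMType, §4 Prop. 4.9 (proof), p. 12;
§3 Prop. 3.3, p. 9] -/
theorem finrank_traceDual_quotient_eq_one_of_ne (hp : p.Prime) (h2 : 2 ≤ Fintype.card ι)
    {T : FractionalIdeal (endOrder (Algebra.leftMulMatrix μ))⁰ K}
    (hT : (T : Submodule (endOrder (Algebra.leftMulMatrix μ)) K) =
      traceDual ℤ ℚ ((1 : FractionalIdeal (endOrder (Algebra.leftMulMatrix μ))⁰ K) :
        Submodule (endOrder (Algebra.leftMulMatrix μ)) K))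
    {𝔮 : Ideal (endOrder (Algebra.leftMulMatrix μ))} [h𝔮 : 𝔮.IsPrime] (h0 : 𝔮 ≠ ⊥) (hne : 𝔮 ≠ 𝔭) :
    Module.finrank (endOrder (Algebra.leftMulMatrix μ) ⧸ 𝔮)
      ((T : Submodule (endOrder (Algebra.leftMulMatrix μ)) K) ⧸
        (𝔮 • ⊤ : Submodule (endOrder (Algebra.leftMulMatrix μ))
          (T : Submodule (endOrder (Algebra.leftMulMatrix μ)) K))) = 1 := by
  by_cases hu : IsUnit (𝔮 : FractionalIdeal (endOrder (Algebra.leftMulMatrix μ))⁰ K)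
  · exact finrank_traceDual_quotient_eq_one_of_isUnit_coeIdeal μ hT h0 hu
  · exact absurd (eq_of_not_isUnit_coeIdeal μ h𝔯 h𝔭 hp h2 h0 hu) hne

/-- **MARSEGLIA 2024 PROPOSITION 4.9 / MAIN THEOREM 1 (3), «Moreover, this bound is attained»: for `T = ℤ + p𝒪_K`,
`type(T) = max_𝔮 type_𝔮(T) = [K:ℚ] − 1`** — every nonzero prime has type `≤ [K:ℚ] − 1`
(`CMOrderCohenMacaulayTypeBound`) and the prime `p𝒪_K` has type exactly `[K:ℚ] − 1`. [cite: Marseglia2024CMType, §4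
Prop. 4.9, pp. 11–12; §1 Main Theorem 1 (3), p. 3] -/
theorem type_eq_card_sub_one (hp : p.Prime) (h2 : 2 ≤ Fintype.card ι)
    {T : FractionalIdeal (endOrder (Algebra.leftMulMatrix μ))⁰ K}
    (hT : (T : Submodule (endOrder (Algebra.leftMulMatrix μ)) K) =
      traceDual ℤ ℚ ((1 : FractionalIdeal (endOrder (Algebra.leftMulMatrix μ))⁰ K) :
        Submodule (endOrder (Algebra.leftMulMatrix μ)) K)) :
    (∀ 𝔮 : Ideal (endOrder (Algebra.leftMulMatrix μ)), 𝔮.IsPrime → 𝔮 ≠ ⊥ →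
      Module.finrank (endOrder (Algebra.leftMulMatrix μ) ⧸ 𝔮)
        ((T : Submodule (endOrder (Algebra.leftMulMatrix μ)) K) ⧸
          (𝔮 • ⊤ : Submodule (endOrder (Algebra.leftMulMatrix μ))
            (T : Submodule (endOrder (Algebra.leftMulMatrix μ)) K))) ≤ Fintype.card ι - 1) ∧
    𝔭.IsPrime ∧ 𝔭 ≠ ⊥ ∧
      Module.finrank (endOrder (Algebra.leftMulMatrix μ) ⧸ 𝔭)
        ((T : Submodule (endOrder (Algebra.leftMulMatrix μ)) K) ⧸
          (𝔭 • ⊤ : Submodule (endOrder (Algebra.leftMulMatrix μ))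
            (T : Submodule (endOrder (Algebra.leftMulMatrix μ)) K))) = Fintype.card ι - 1 :=
  ⟨fun 𝔮 h𝔮 h0 ↦ by haveI := h𝔮; exact finrank_traceDual_quotient_le_card_sub_one μ hT h2 h0,
    (isMaximal μ h𝔯 h𝔭 hp).isPrime, ne_bot μ h𝔭 hp.ne_zero,
    finrank_traceDual_quotient_eq_card_sub_one μ h𝔯 h𝔭 hp h2 hT⟩

end ZPlusP

/-- **MARSEGLIA 2024 MAIN THEOREM 1 (3), «Moreover», basis-free: in every number field of degree `n ≥ 2`, for every
prime number `p` there is an order — namely `ℤ + p𝒪_K` — with a (maximal) prime at which the Cohen–Macaulay type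
is `n − 1`**, so the bound `type ≤ n − 1` of `CMOrderCohenMacaulayTypeBound` is sharp. [cite: Marseglia2024CMType, §1
Main Theorem 1 (3), p. 3; §4 Prop. 4.9, pp. 11–12] -/
theorem exists_order_type_eq_card_sub_one [Nonempty ι] (μ₀ : Basis ι ℚ K) (h2 : 2 ≤ Fintype.card ι) {p : ℕ}
    (hp : p.Prime) :
    ∃ ν : Basis ι ℚ K, (∀ x : K, x ∈ endOrder (Algebra.leftMulMatrix ν) ↔ ∃ (m : ℤ) (y : 𝓞 K), x = m + p * y) ∧
      ∀ T : FractionalIdeal (endOrder (Algebra.leftMulMatrix ν))⁰ K,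
        (T : Submodule (endOrder (Algebra.leftMulMatrix ν)) K) =
          traceDual ℤ ℚ ((1 : FractionalIdeal (endOrder (Algebra.leftMulMatrix ν))⁰ K) :
            Submodule (endOrder (Algebra.leftMulMatrix ν)) K) →
        ∃ 𝔭 : Ideal (endOrder (Algebra.leftMulMatrix ν)), 𝔭.IsMaximal ∧
          Module.finrank (endOrder (Algebra.leftMulMatrix ν) ⧸ 𝔭)
            ((T : Submodule (endOrder (Algebra.leftMulMatrix ν)) K) ⧸
              (𝔭 • ⊤ : Submodule (endOrder (Algebra.leftMulMatrix ν))
                (T : Submodule (endOrder (Algebra.leftMulMatrix ν)) K))) = Fintype.card ι - 1 := by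
  obtain ⟨ν, hν⟩ := exists_basis_mem_endOrder_iff μ₀ hp.ne_zero
  haveI := isFractionRing_endOrder (Algebra.leftMulMatrix ν)
  obtain ⟨𝔭, h𝔭⟩ := exists_ideal_mem_iff ν hν
  exact ⟨ν, hν, fun T hT ↦ ⟨𝔭, isMaximal ν hν h𝔭 hp, finrank_traceDual_quotient_eq_card_sub_one ν hν h𝔭 hp h2 hT⟩⟩

end CMTypeLattice

end Literature.NumberTheory.ComplexMultiplication
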